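import Mathlib.NumberTheory.Padics.PadicVal.Basic
import Mathlib.Algebra.Order.Floor.Semifield
import Mathlib.Algebra.Order.Archimedean.Real.Basic
import HarnessLib

/-!
# Large primes in factorial ratios: `v_p((hn)!) = h⌊n/p⌋ + ⌊h{n/p}⌋` and the Rhin–Viola class set `Ω`

Topic `Literature/NumberTheory/DiophantineApproximation`. Everything here is PROVED from Mathlib (no
definitions, no named facts).

In the permutation group method (Rhin–Viola; Viola–Zudilin 2018, §3 and §6.1) the arithmetic gain comes from
the primes `p > √(Hn)`: for such `p` each factorial `(hn)!` carries exactly one Legendre digit,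
`v_p((hn)!) = ⌊hn/p⌋ = h⌊n/p⌋ + ⌊hω⌋` with `ω = {n/p}`, so that the `p`-adic valuation of a quotient of
products of such factorials with balanced parameters, e.g. `(hn)!(jn)!/((h+m−k)n)!((j+k−m)n)!`
(Viola–Zudilin, Lemma 3.2), is the step function `⌊hω⌋ + ⌊jω⌋ − ⌊(h+m−k)ω⌋ − ⌊(j+k−m)ω⌋` of `ω = {n/p}`,
and `p` divides the (integer) coefficients exactly on the class set
`Ω = {ω ∈ [0,1) : ⌊(h+m−k)ω⌋ + ⌊(j+k−m)ω⌋ < ⌊hω⌋ + ⌊jω⌋}` (Viola–Zudilin, (6.1)).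

* `padicValNat_factorial_of_lt_sq` — `v_p(m!) = ⌊m/p⌋` for `m < p²` (Legendre, one digit);
* `mul_div_eq_mul_div_add` — `⌊hn/p⌋ = h⌊n/p⌋ + ⌊h(n mod p)/p⌋`;
* `floor_mul_fract_div_eq` — `⌊h·{n/p}⌋ = ⌊h(n mod p)/p⌋` (the class function in real terms);
* `padicValNat_factorial_mul_of_lt_sq` — `v_p((hn)!) = h⌊n/p⌋ + ⌊h(n mod p)/p⌋` for `hn < p²`;
* `padicValNat_factorial_prod_balance` — for `a₁ + a₂ = b₁ + b₂`:
  `v_p((a₁n)!(a₂n)!) + (⌊b₁r/p⌋ + ⌊b₂r/p⌋) = v_p((b₁n)!(b₂n)!) + (⌊a₁r/p⌋ + ⌊a₂r/p⌋)`, `r = n mod p`;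
* `dvd_of_mul_factorial_eq` — the divisibility transfer: if `X·(b₁n)!(b₂n)! = Y·(a₁n)!(a₂n)!` and
  `⌊b₁r/p⌋ + ⌊b₂r/p⌋ < ⌊a₁r/p⌋ + ⌊a₂r/p⌋` (i.e. `{n/p} ∈ Ω`) then `p ∣ X`.

## References

* C. Viola, W. Zudilin, *Linear independence of dilogarithmic values*, J. reine angew. Math. 736 (2018),
  Lemma 3.2, Proposition 3.1, (6.1). [ViolaZudilin2018]
* G. Rhin, C. Viola, *The permutation group method for the dilogarithm*, Ann. Sc. Norm. Super. Pisa (5) 4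
  (2005) 389–437, §4.
-/

namespace Literature.NumberTheory.DiophantineApproximation

namespace RhinViola

open Nat

/-! ### One Legendre digit -/

/-- **Legendre's formula with one digit**: for a prime `p` and `m < p²`, `v_p(m!) = ⌊m/p⌋`. [folklore] -/
theorem padicValNat_factorial_of_lt_sq {p m : ℕ} [hp : Fact p.Prime] (hm : m < p ^ 2) :
    padicValNat p m ! = m / p := by
  have hlog : Nat.log p m < 2 := Nat.log_lt_of_lt_pow' two_ne_zero hm
  rw [padicValNat_factorial hlog, Finset.sum_Ico_eq_sum_range]
  simp

/-- `⌊hn/p⌋ = h⌊n/p⌋ + ⌊h (n mod p)/p⌋` (`n = p⌊n/p⌋ + n mod p`). [folklore] -/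
theorem mul_div_eq_mul_div_add (h n : ℕ) {p : ℕ} (hp : 0 < p) :
    h * n / p = h * (n / p) + h * (n % p) / p := by
  have hn : h * n = h * (n % p) + h * (n / p) * p := by
    have := Nat.div_add_mod n p
    nlinarith [this]
  rw [hn, Nat.add_mul_div_right _ _ hp, Nat.add_comm]

/-- **`v_p((hn)!) = h⌊n/p⌋ + ⌊h(n mod p)/p⌋`** for a prime `p` with `hn < p²` (the primes `p > √(Hn)` of
the permutation group method). [cite: ViolaZudilin2018, §6.1 (Δ_n, after Rhin–Viola)] -/
theorem padicValNat_factorial_mul_of_lt_sq {p : ℕ} [Fact p.Prime] (h n : ℕ) (hlt : h * n < p ^ 2) :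
    padicValNat p (h * n)! = h * (n / p) + h * (n % p) / p := by
  rw [padicValNat_factorial_of_lt_sq hlt, mul_div_eq_mul_div_add h n (Fact.out : p.Prime).pos]

/-- The class function in real terms: `⌊h · {n/p}⌋ = ⌊h (n mod p)/p⌋` (`{n/p} = (n mod p)/p`).
[folklore] -/
theorem floor_mul_fract_div_eq (h n p : ℕ) :
    ⌊(h : ℝ) * Int.fract ((n : ℝ) / p)⌋₊ = h * (n % p) / p := by
  rw [Int.fract_div_natCast_eq_div_natCast_mod, ← Nat.floor_div_eq_div (K := ℝ) (h * (n % p)) p]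
  congr 1
  push_cast
  ring

/-! ### Balanced factorial ratios and the class set `Ω` -/

/-- **Valuation of a balanced factorial ratio at a large prime.** For a prime `p`, `a₁ + a₂ = b₁ + b₂`
and `aᵢ n, bᵢ n < p²`: with `r = n mod p`,
`v_p((a₁n)!(a₂n)!) + (⌊b₁r/p⌋ + ⌊b₂r/p⌋) = v_p((b₁n)!(b₂n)!) + (⌊a₁r/p⌋ + ⌊a₂r/p⌋)`, i.e.
`v_p((a₁n)!(a₂n)!/((b₁n)!(b₂n)!)) = ⌊a₁ω⌋ + ⌊a₂ω⌋ − ⌊b₁ω⌋ − ⌊b₂ω⌋`, `ω = {n/p}` (the `⌊n/p⌋` parts cancel).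
[cite: ViolaZudilin2018, Lemma 3.2 and (6.1)] -/
theorem padicValNat_factorial_prod_balance {p : ℕ} [Fact p.Prime] {a₁ a₂ b₁ b₂ : ℕ} (n : ℕ)
    (hbal : a₁ + a₂ = b₁ + b₂) (ha₁ : a₁ * n < p ^ 2) (ha₂ : a₂ * n < p ^ 2) (hb₁ : b₁ * n < p ^ 2)
    (hb₂ : b₂ * n < p ^ 2) :
    padicValNat p ((a₁ * n)! * (a₂ * n)!) + (b₁ * (n % p) / p + b₂ * (n % p) / p)
      = padicValNat p ((b₁ * n)! * (b₂ * n)!) + (a₁ * (n % p) / p + a₂ * (n % p) / p) := by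
  rw [padicValNat.mul (factorial_ne_zero _) (factorial_ne_zero _),
    padicValNat.mul (factorial_ne_zero _) (factorial_ne_zero _),
    padicValNat_factorial_mul_of_lt_sq a₁ n ha₁, padicValNat_factorial_mul_of_lt_sq a₂ n ha₂,
    padicValNat_factorial_mul_of_lt_sq b₁ n hb₁, padicValNat_factorial_mul_of_lt_sq b₂ n hb₂]
  have hk : a₁ * (n / p) + a₂ * (n / p) = b₁ * (n / p) + b₂ * (n / p) := by
    rw [← Nat.add_mul, ← Nat.add_mul, hbal]
  omega

/-- **Divisibility transfer on the class set** (the mechanism behind `Δ_n` in the permutation group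
method): if natural numbers `X, Y` satisfy `X · (b₁n)!(b₂n)! = Y · (a₁n)!(a₂n)!` with `a₁ + a₂ = b₁ + b₂`,
`aᵢn, bᵢn < p²`, and `⌊b₁r/p⌋ + ⌊b₂r/p⌋ < ⌊a₁r/p⌋ + ⌊a₂r/p⌋` for `r = n mod p` (that is, `{n/p} ∈ Ω`), then
`p ∣ X`. [cite: ViolaZudilin2018, Prop. 3.1 and §6.1] -/
theorem dvd_of_mul_factorial_eq {p : ℕ} [hp : Fact p.Prime] {a₁ a₂ b₁ b₂ : ℕ} (n : ℕ)
    (hbal : a₁ + a₂ = b₁ + b₂) (ha₁ : a₁ * n < p ^ 2) (ha₂ : a₂ * n < p ^ 2) (hb₁ : b₁ * n < p ^ 2)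
    (hb₂ : b₂ * n < p ^ 2)
    (hΩ : b₁ * (n % p) / p + b₂ * (n % p) / p < a₁ * (n % p) / p + a₂ * (n % p) / p)
    {X Y : ℕ} (hXY : X * ((b₁ * n)! * (b₂ * n)!) = Y * ((a₁ * n)! * (a₂ * n)!)) : p ∣ X := by
  rcases Nat.eq_zero_or_pos X with rfl | hX
  · exact dvd_zero p
  have hB : (b₁ * n)! * (b₂ * n)! ≠ 0 := mul_ne_zero (factorial_ne_zero _) (factorial_ne_zero _)
  have hA : (a₁ * n)! * (a₂ * n)! ≠ 0 := mul_ne_zero (factorial_ne_zero _) (factorial_ne_zero _)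
  have hY : Y ≠ 0 := by
    rintro rfl
    rw [zero_mul] at hXY
    exact (mul_ne_zero hX.ne' hB) hXY
  have hval := congrArg (padicValNat p) hXY
  rw [padicValNat.mul hX.ne' hB, padicValNat.mul hY hA] at hval
  have hbalv := padicValNat_factorial_prod_balance (p := p) n hbal ha₁ ha₂ hb₁ hb₂
  have hpos : 0 < padicValNat p X := by omega
  exact dvd_of_one_le_padicValNat hpos

/-- The class condition in real terms: with `ω = {n/p}`,
`⌊b₁ω⌋ + ⌊b₂ω⌋ < ⌊a₁ω⌋ + ⌊a₂ω⌋ ↔ ⌊b₁r/p⌋ + ⌊b₂r/p⌋ < ⌊a₁r/p⌋ + ⌊a₂r/p⌋` (`r = n mod p`), the form of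
the set `Ω` of (6.1). [cite: ViolaZudilin2018, (6.1)] -/
theorem class_condition_iff (p n a₁ a₂ b₁ b₂ : ℕ) :
    ⌊(b₁ : ℝ) * Int.fract ((n : ℝ) / p)⌋₊ + ⌊(b₂ : ℝ) * Int.fract ((n : ℝ) / p)⌋₊
        < ⌊(a₁ : ℝ) * Int.fract ((n : ℝ) / p)⌋₊ + ⌊(a₂ : ℝ) * Int.fract ((n : ℝ) / p)⌋₊ ↔
      b₁ * (n % p) / p + b₂ * (n % p) / p < a₁ * (n % p) / p + a₂ * (n % p) / p := by
  simp only [floor_mul_fract_div_eq]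

end RhinViola

end Literature.NumberTheory.DiophantineApproximation
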